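import Summits.Ventures.PercRepro.RankLevelSetSpanningTriangles

/-!
# PercRepro — MANY DISJOINT TRIANGLES FROM A TRIANGLE COVER (p8 g14, S3): the matching lever, part 1

In a finite matroid of nullity `d` on `n` points where every point lies on a triangle and every rank-`2` set has at
most `3` points, some `n − 2d` triangles are pairwise disjoint (`exists_disjoint_triangles`): a maximum family of
pairwise disjoint triangles `Dm` (`m` members) meets every triangle; the points outside `∪Dm` are covered by triangles
each carrying at most two of them, a minimal subcover `𝒯` has a private outside point per member, and removing one point
per member of `Dm` and the private points of `𝒯` does not change the rank (`eRk_add_encard_le_of_subset_closure`), so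
`d ≥ m + |𝒯| ≥ m + (n − 3m)/2`. Axioms: standard.
-/

namespace PercRepro

open Finset Set

variable {α : Type*}

namespace Matroid

variable {M : _root_.Matroid α}

/-- **Removable points**: if every point of `X` lies in the closure of `X ∖ P` (`P ⊆ X`), then `r(X) + |P| ≤ |X|`. -/
theorem eRk_add_encard_le_of_subset_closure {X P : Set α} (hP : P ⊆ X) (hcl : X ⊆ M.closure (X \ P)) :
    M.eRk X + P.encard ≤ X.encard := by
  have h1 : M.eRk X ≤ M.eRk (X \ P) := by
    calc M.eRk X ≤ M.eRk (M.closure (X \ P)) := M.eRk_mono hcl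
      _ = M.eRk (X \ P) := M.eRk_closure_eq _
  have h2 : M.eRk (X \ P) ≤ (X \ P).encard := M.eRk_le_encard _
  have h3 : (X \ P).encard + P.encard = X.encard := Set.encard_sdiff_add_encard_of_subset hP
  calc M.eRk X + P.encard ≤ (X \ P).encard + P.encard := by gcongr; exact h1.trans h2
    _ = X.encard := h3

/-- A point of a circuit `C ⊆ X` whose other points avoid `P` lies in the closure of `X ∖ P`. -/
theorem mem_closure_sdiff_of_isCircuit {X P C : Set α} {x : α} (hC : M.IsCircuit C) (hx : x ∈ C)
    (hCX : C ⊆ X) (hCP : ∀ y ∈ C, y ≠ x → y ∉ P) : x ∈ M.closure (X \ P) := by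
  have h1 : x ∈ M.closure (C \ {x}) := hC.mem_closure_sdiff_singleton_of_mem hx
  have h2 : C \ {x} ⊆ X \ P := by
    intro y hy
    exact ⟨hCX hy.1, hCP y hy.1 (by simpa using hy.2)⟩
  exact M.closure_mono h2 h1

/-- `r(X) ≤ r(Y)` when `X ⊆ cl(Y)`. -/
theorem eRk_le_eRk_of_subset_closure {X Y : Set α} (h : X ⊆ M.closure Y) : M.eRk X ≤ M.eRk Y := by
  calc M.eRk X ≤ M.eRk (M.closure Y) := M.eRk_mono h
    _ = M.eRk Y := M.eRk_closure_eq _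

end Matroid

/-- The union of finitely many finite sets has at most the sum of their sizes. -/
theorem ncard_biUnion_le_sum {ι : Type*} (s : Finset ι) (f : ι → Set α) (hf : ∀ i ∈ s, (f i).Finite) :
    (⋃ i ∈ s, f i).ncard ≤ ∑ i ∈ s, (f i).ncard := by
  classical
  induction s using Finset.induction_on with
  | empty => simp
  | insert a s ha ih =>
    rw [Finset.set_biUnion_insert, Finset.sum_insert ha]
    have hfin : (⋃ i ∈ s, f i).Finite := s.finite_toSet.biUnion (fun i hi => hf i (Finset.mem_insert_of_mem hi))
    calc (f a ∪ ⋃ i ∈ s, f i).ncard ≤ (f a).ncard + (⋃ i ∈ s, f i).ncard :=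
          Set.ncard_union_le _ _
      _ ≤ (f a).ncard + ∑ i ∈ s, (f i).ncard := by
          have := ih (fun i hi => hf i (Finset.mem_insert_of_mem hi)); omega


/-! ### Counting the `j`-subsets meeting every member of a family of pairwise disjoint triangles -/

open Classical in
/-- **The transversal count**: the `j`-subsets of a finset `E` meeting every member of a family `𝓘` of pairwise disjoint
`3`-sets number at most `3^{|𝓘|}·C(|E|, j − |𝓘|)` (pick a point in each member; the rest is arbitrary). -/
theorem card_filter_meets_all_le (E : Finset α) (𝓘 : Finset (Set α))
    (h3 : ∀ T ∈ 𝓘, T.ncard = 3) (hE : ∀ T ∈ 𝓘, T ⊆ (E : Set α))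
    (hdisj : ∀ T ∈ 𝓘, ∀ T' ∈ 𝓘, T ≠ T' → Disjoint T T') (j : ℕ) :
    ((E.powersetCard j).filter (fun s : Finset α => ∀ T ∈ 𝓘, ((s : Set α) ∩ T).Nonempty)).card ≤
      3 ^ 𝓘.card * E.card.choose (j - 𝓘.card) := by
  induction 𝓘 using Finset.induction_on generalizing j with
  | empty =>
    rw [Finset.filter_true_of_mem (fun s _ T hT => absurd hT (Finset.notMem_empty T)), Finset.card_powersetCard]
    simp
  | insert T 𝓘 hT ih =>
    have hTfin : T.Finite := E.finite_toSet.subset (hE T (Finset.mem_insert_self T 𝓘))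
    have hT3 : T.ncard = 3 := h3 T (Finset.mem_insert_self T 𝓘)
    have hTne : T.Nonempty := Set.nonempty_of_ncard_ne_zero (by omega)
    haveI : Nonempty α := ⟨hTne.choose⟩
    set Tf : Finset α := hTfin.toFinset with hTf
    have hTfc : Tf.card = 3 := by rw [← hT3, Set.ncard_eq_toFinset_card T hTfin]
    have ih' := ih (fun T' hT' => h3 T' (Finset.mem_insert_of_mem hT')) (fun T' hT' => hE T' (Finset.mem_insert_of_mem hT'))
      (fun T' hT' T'' hT'' hne => hdisj T' (Finset.mem_insert_of_mem hT') T'' (Finset.mem_insert_of_mem hT'') hne) (j - 1)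
    -- the injection `s ↦ (x, s.erase x)` with `x ∈ s ∩ T`
    set A := (E.powersetCard j).filter (fun s : Finset α => ∀ T' ∈ insert T 𝓘, ((s : Set α) ∩ T').Nonempty) with hA
    set B := (E.powersetCard (j - 1)).filter (fun s : Finset α => ∀ T' ∈ 𝓘, ((s : Set α) ∩ T').Nonempty) with hB
    let pick : Finset α → α := fun s => Classical.epsilon (fun x => x ∈ s ∧ x ∈ T)
    have hpick : ∀ s ∈ A, pick s ∈ s ∧ pick s ∈ T := by
      intro s hs
      rw [hA, Finset.mem_filter] at hs
      obtain ⟨x, hx⟩ := hs.2 T (Finset.mem_insert_self T 𝓘)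
      exact Classical.epsilon_spec (p := fun x => x ∈ s ∧ x ∈ T) ⟨x, Finset.mem_coe.1 hx.1, hx.2⟩
    have hmaps : ∀ s ∈ A, (pick s, s.erase (pick s)) ∈ Tf ×ˢ B := by
      intro s hs
      obtain ⟨hx1, hx2⟩ := hpick s hs
      rw [hA, Finset.mem_filter, Finset.mem_powersetCard] at hs
      rw [Finset.mem_product]
      refine ⟨by rw [hTf, Set.Finite.mem_toFinset]; exact hx2, ?_⟩
      rw [hB, Finset.mem_filter, Finset.mem_powersetCard]
      refine ⟨⟨(Finset.erase_subset _ _).trans hs.1.1, by rw [Finset.card_erase_of_mem hx1, hs.1.2]⟩, ?_⟩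
      intro T' hT'
      obtain ⟨y, hy⟩ := hs.2 T' (Finset.mem_insert_of_mem hT')
      refine ⟨y, ?_, hy.2⟩
      rw [Finset.mem_coe, Finset.mem_erase]
      refine ⟨?_, Finset.mem_coe.1 hy.1⟩
      intro hyx
      subst hyx
      have hne : T ≠ T' := fun h => hT (h ▸ hT')
      exact Set.disjoint_left.1 (hdisj T (Finset.mem_insert_self T 𝓘) T' (Finset.mem_insert_of_mem hT') hne) hx2 hy.2
    have hinj : Set.InjOn (fun s : Finset α => (pick s, s.erase (pick s))) (A : Set (Finset α)) := by
      intro s hs s' hs' heq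
      simp only [Prod.mk.injEq] at heq
      have h1 := (hpick s hs).1
      have h2 := (hpick s' hs').1
      rw [← Finset.insert_erase h1, ← Finset.insert_erase h2, heq.2, heq.1]
    have hcard := Finset.card_le_card_of_injOn _ hmaps hinj
    rw [Finset.card_product, hTfc] at hcard
    have hB' : B.card ≤ 3 ^ 𝓘.card * E.card.choose (j - 1 - 𝓘.card) := ih'
    rw [Finset.card_insert_of_notMem hT, pow_succ, show j - (𝓘.card + 1) = j - 1 - 𝓘.card by omega]
    calc A.card ≤ 3 * B.card := hcard
      _ ≤ 3 * (3 ^ 𝓘.card * E.card.choose (j - 1 - 𝓘.card)) := by gcongr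
      _ = 3 ^ 𝓘.card * 3 * E.card.choose (j - 1 - 𝓘.card) := by ring

namespace Matroid

variable {M : _root_.Matroid α} [M.Finite]

/-- **MANY DISJOINT TRIANGLES FROM A TRIANGLE COVER.** In a finite matroid with `|E| = r(E) + d` where every point lies on
a triangle and every rank-`2` set has at most `3` points, there is a family `Dm` of pairwise disjoint triangles with
`|E| ≤ |Dm| + 2d`. -/
theorem exists_disjoint_triangles {d : ℕ} (hd : M.E.encard = M.eRank + d)
    (hcov : ∀ x ∈ M.E, ∃ C, M.IsCircuit C ∧ C.ncard = 3 ∧ x ∈ C) :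
    ∃ Dm : Finset (Set α), (∀ C ∈ Dm, M.IsCircuit C ∧ C.ncard = 3) ∧
      (∀ C ∈ Dm, ∀ C' ∈ Dm, C ≠ C' → Disjoint C C') ∧ M.E.ncard ≤ Dm.card + 2 * d := by
  classical
  -- the triangles as a finset
  have hTfin : {C : Set α | M.IsCircuit C ∧ C.ncard = 3}.Finite :=
    M.ground_finite.finite_subsets.subset (fun _ hC => hC.1.subset_ground)
  set TF : Finset (Set α) := hTfin.toFinset with hTF
  have hmemTF : ∀ C, C ∈ TF ↔ M.IsCircuit C ∧ C.ncard = 3 := by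
    intro C; rw [hTF, Set.Finite.mem_toFinset]; rfl
  -- a maximum family of pairwise disjoint triangles
  set Pm : Finset (Finset (Set α)) :=
    TF.powerset.filter (fun Dm => ∀ C ∈ Dm, ∀ C' ∈ Dm, C ≠ C' → Disjoint C C') with hPm
  have hPmne : Pm.Nonempty := ⟨∅, by simp [hPm]⟩
  obtain ⟨Dm, hDmmem, hDmmax⟩ := Finset.exists_max_image Pm Finset.card hPmne
  have hDmsub : Dm ⊆ TF := Finset.mem_powerset.1 (Finset.mem_filter.1 hDmmem).1
  have hDmdisj : ∀ C ∈ Dm, ∀ C' ∈ Dm, C ≠ C' → Disjoint C C' := (Finset.mem_filter.1 hDmmem).2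
  have hDmtri : ∀ C ∈ Dm, M.IsCircuit C ∧ C.ncard = 3 := fun C hC => (hmemTF C).1 (hDmsub hC)
  refine ⟨Dm, hDmtri, hDmdisj, ?_⟩
  -- the covered points and the rest
  set V₀ : Set α := ⋃ C ∈ Dm, C with hV₀
  have hV₀E : V₀ ⊆ M.E := by
    intro x hx
    rw [hV₀, Set.mem_iUnion₂] at hx
    obtain ⟨C, hC, hxC⟩ := hx
    exact (hDmtri C hC).1.subset_ground hxC
  have hV₀fin : V₀.Finite := M.ground_finite.subset hV₀E
  have hV₀card : V₀.ncard ≤ 3 * Dm.card := by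
    have := ncard_biUnion_le_sum Dm (fun C => C) (fun C hC => M.ground_finite.subset (hDmtri C hC).1.subset_ground)
    have hsum : ∑ C ∈ Dm, C.ncard = ∑ C ∈ Dm, 3 := Finset.sum_congr rfl (fun C hC => (hDmtri C hC).2)
    rw [hsum, Finset.sum_const, smul_eq_mul] at this
    rw [hV₀]; omega
  -- every triangle meets `V₀` (maximality)
  have hmeet : ∀ T, M.IsCircuit T → T.ncard = 3 → (T ∩ V₀).Nonempty := by
    intro T hT hT3
    by_contra hno
    rw [Set.not_nonempty_iff_eq_empty] at hno
    have hTnot : T ∉ Dm := by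
      intro hTin
      have hTV : T ⊆ V₀ := fun x hx => by rw [hV₀, Set.mem_iUnion₂]; exact ⟨T, hTin, hx⟩
      have : T ∩ V₀ = T := Set.inter_eq_left.2 hTV
      rw [this] at hno
      have h3 := hT3
      rw [hno, Set.ncard_empty] at h3
      omega
    have hins : insert T Dm ∈ Pm := by
      rw [hPm, Finset.mem_filter, Finset.mem_powerset]
      refine ⟨Finset.insert_subset ((hmemTF T).2 ⟨hT, hT3⟩) hDmsub, ?_⟩
      intro C hC C' hC' hne
      rw [Finset.mem_insert] at hC hC'
      have hdisjT : ∀ C₀ ∈ Dm, Disjoint T C₀ := by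
        intro C₀ hC₀
        rw [Set.disjoint_iff_inter_eq_empty]
        apply Set.eq_empty_of_subset_empty
        rw [← hno]
        exact Set.inter_subset_inter_right _ (fun x hx => by rw [hV₀, Set.mem_iUnion₂]; exact ⟨C₀, hC₀, hx⟩)
      rcases hC with rfl | hC <;> rcases hC' with rfl | hC'
      · exact absurd rfl hne
      · exact hdisjT C' hC'
      · exact (hdisjT C hC).symm
      · exact hDmdisj C hC C' hC' hne
    have := hDmmax _ hins
    rw [Finset.card_insert_of_notMem hTnot] at this
    omega
  -- the rest `R = E ∖ V₀` and a minimum cover of it by triangles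
  set R : Set α := M.E \ V₀ with hR
  have hRfin : R.Finite := M.ground_finite.subset Set.sdiff_subset
  set Cov : Finset (Finset (Set α)) :=
    TF.powerset.filter (fun 𝒯 => R ⊆ ⋃ T ∈ 𝒯, T) with hCov
  have hCovne : Cov.Nonempty := by
    refine ⟨TF, ?_⟩
    rw [hCov, Finset.mem_filter, Finset.mem_powerset]
    refine ⟨le_rfl, ?_⟩
    intro x hx
    obtain ⟨C, hC, hC3, hxC⟩ := hcov x hx.1
    rw [Set.mem_iUnion₂]
    exact ⟨C, (hmemTF C).2 ⟨hC, hC3⟩, hxC⟩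
  obtain ⟨Tm, hTmmem, hTmmin⟩ := Finset.exists_min_image Cov Finset.card hCovne
  have hTmsub : Tm ⊆ TF := Finset.mem_powerset.1 (Finset.mem_filter.1 hTmmem).1
  have hTmcov : R ⊆ ⋃ T ∈ Tm, T := (Finset.mem_filter.1 hTmmem).2
  have hTmtri : ∀ T ∈ Tm, M.IsCircuit T ∧ T.ncard = 3 := fun T hT => (hmemTF T).1 (hTmsub hT)
  -- every member of the minimum cover has a private point of `R`
  have hpriv : ∀ T ∈ Tm, ∃ q ∈ T ∩ R, ∀ T' ∈ Tm, T' ≠ T → q ∉ T' := by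
    intro T hT
    by_contra hno
    have hno' : ∀ x ∈ T ∩ R, ∃ T₁ ∈ Tm, T₁ ≠ T ∧ x ∈ T₁ := by
      intro x hx
      by_contra h2
      exact hno ⟨x, hx, fun T₁ hT₁ hne hxT₁ => h2 ⟨T₁, hT₁, hne, hxT₁⟩⟩
    -- then `Tm.erase T` still covers `R`
    have hcov' : R ⊆ ⋃ T₁ ∈ Tm.erase T, T₁ := by
      intro x hx
      have hx' := hTmcov hx
      rw [Set.mem_iUnion₂] at hx'
      obtain ⟨T₁, hT₁, hxT₁⟩ := hx'
      rw [Set.mem_iUnion₂]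
      by_cases hTT : T₁ = T
      · subst hTT
        obtain ⟨T₂, hT₂, hne, hxT₂⟩ := hno' x ⟨hxT₁, hx⟩
        exact ⟨T₂, Finset.mem_erase.2 ⟨hne, hT₂⟩, hxT₂⟩
      · exact ⟨T₁, Finset.mem_erase.2 ⟨hTT, hT₁⟩, hxT₁⟩
    have hmem' : Tm.erase T ∈ Cov := by
      rw [hCov, Finset.mem_filter, Finset.mem_powerset]
      exact ⟨(Finset.erase_subset T Tm).trans hTmsub, hcov'⟩
    have := hTmmin _ hmem'
    rw [Finset.card_erase_of_mem hT] at this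
    have hpos : 0 < Tm.card := Finset.card_pos.2 ⟨T, hT⟩
    omega
  -- total choice functions (the ground set is nonempty: `R` or `V₀` carries a point unless `E = ∅`)
  rcases isEmpty_or_nonempty α with hα | hα
  · have : M.E = ∅ := Set.eq_empty_of_isEmpty _
    rw [this, Set.ncard_empty]; omega
  have hpriv' : ∀ T, ∃ x : α, T ∈ Tm → (x ∈ T ∩ R ∧ ∀ T' ∈ Tm, T' ≠ T → x ∉ T') := by
    intro T
    by_cases hT : T ∈ Tm
    · obtain ⟨x, hx1, hx2⟩ := hpriv T hT
      exact ⟨x, fun _ => ⟨hx1, hx2⟩⟩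
    · exact ⟨Classical.arbitrary α, fun h => absurd h hT⟩
  choose q hq using hpriv'
  have hpick : ∀ C, ∃ x : α, C ∈ Dm → x ∈ C := by
    intro C
    by_cases hC : C ∈ Dm
    · have h3 := (hDmtri C hC).2
      have hne : C.Nonempty := Set.nonempty_of_ncard_ne_zero (by omega)
      exact ⟨hne.choose, fun _ => hne.choose_spec⟩
    · exact ⟨Classical.arbitrary α, fun h => absurd h hC⟩
  choose p hp using hpick
  -- each cover member meets `V₀`, so it carries at most two points of `R`
  have hTR : ∀ T ∈ Tm, (T ∩ R).ncard ≤ 2 := by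
    intro T hT
    obtain ⟨hTc, hT3⟩ := hTmtri T hT
    have hTfin : T.Finite := M.ground_finite.subset hTc.subset_ground
    obtain ⟨v, hv⟩ := hmeet T hTc hT3
    have hsub : T ∩ R ⊆ T \ {v} := by
      intro x hx
      refine ⟨hx.1, ?_⟩
      intro hxv
      rw [Set.mem_singleton_iff] at hxv
      subst hxv
      exact hx.2.2 hv.2
    have h1 := Set.ncard_le_ncard hsub (hTfin.subset Set.sdiff_subset)
    have h2 : (T \ {v}).ncard = T.ncard - 1 := Set.ncard_sdiff_singleton_of_mem hv.1
    omega
  have hRcard : R.ncard ≤ 2 * Tm.card := by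
    have hsub : R ⊆ ⋃ T ∈ Tm, (T ∩ R) := by
      intro x hx
      have := hTmcov hx
      rw [Set.mem_iUnion₂] at this ⊢
      obtain ⟨T, hT, hxT⟩ := this
      exact ⟨T, hT, hxT, hx⟩
    have h1 := Set.ncard_le_ncard hsub (Tm.finite_toSet.biUnion (fun T _ => hRfin.subset Set.inter_subset_right))
    have h2 := ncard_biUnion_le_sum Tm (fun T => T ∩ R) (fun T _ => hRfin.subset Set.inter_subset_right)
    have h3 : ∑ T ∈ Tm, (T ∩ R).ncard ≤ ∑ T ∈ Tm, 2 := Finset.sum_le_sum (fun T hT => hTR T hT)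
    rw [Finset.sum_const, smul_eq_mul] at h3
    omega
  -- the nullity: the private points `Q` and one point `p C` of each disjoint triangle are removable
  set X : Set α := V₀ ∪ ⋃ T ∈ Tm, T with hX
  have hXE : X ⊆ M.E := by
    refine Set.union_subset hV₀E ?_
    intro x hx
    rw [Set.mem_iUnion₂] at hx
    obtain ⟨T, hT, hxT⟩ := hx
    exact (hTmtri T hT).1.subset_ground hxT
  set Q : Set α := q '' (Tm : Set (Set α)) with hQ
  set P₀ : Set α := p '' (Dm : Set (Set α)) with hP₀
  have hQR : Q ⊆ R := by
    rintro x ⟨T, hT, rfl⟩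
    exact (hq T (Finset.mem_coe.1 hT)).1.2
  have hQX : Q ⊆ X := by
    rintro x ⟨T, hT, rfl⟩
    have hT2 := Finset.mem_coe.1 hT
    exact Or.inr (by rw [Set.mem_iUnion₂]; exact ⟨T, hT2, (hq T hT2).1.1⟩)
  have hP₀V : P₀ ⊆ V₀ := by
    rintro x ⟨C, hC, rfl⟩
    have hC2 := Finset.mem_coe.1 hC
    rw [hV₀, Set.mem_iUnion₂]; exact ⟨C, hC2, hp C hC2⟩
  have hQinj : Set.InjOn q (Tm : Set (Set α)) := by
    intro T hT T₁ hT₁ heq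
    by_contra hne
    have h1 := (hq T (Finset.mem_coe.1 hT)).2 T₁ (Finset.mem_coe.1 hT₁) (Ne.symm hne)
    have h2 := (hq T₁ (Finset.mem_coe.1 hT₁)).1.1
    rw [← heq] at h2
    exact h1 h2
  have hPinj : Set.InjOn p (Dm : Set (Set α)) := by
    intro C hC C₁ hC₁ heq
    by_contra hne
    have hdisj := hDmdisj C (Finset.mem_coe.1 hC) C₁ (Finset.mem_coe.1 hC₁) hne
    have h1 := hp C (Finset.mem_coe.1 hC)
    have h2 := hp C₁ (Finset.mem_coe.1 hC₁)
    rw [← heq] at h2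
    exact Set.disjoint_left.1 hdisj h1 h2
  have hQcard : Q.ncard = Tm.card := by
    rw [hQ, hQinj.ncard_image, Set.ncard_coe_finset]
  have hPcard : P₀.ncard = Dm.card := by
    rw [hP₀, hPinj.ncard_image, Set.ncard_coe_finset]
  -- step A: `X ⊆ cl(X ∖ Q)`
  have hA : X ⊆ M.closure (X \ Q) := by
    intro x hx
    by_cases hxQ : x ∈ Q
    · obtain ⟨T₀, hT₀, rfl⟩ := hxQ
      have hT₀2 := Finset.mem_coe.1 hT₀
      refine mem_closure_sdiff_of_isCircuit (hTmtri T₀ hT₀2).1 (hq T₀ hT₀2).1.1 ?_ ?_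
      · intro y hy
        exact Or.inr (by rw [Set.mem_iUnion₂]; exact ⟨T₀, hT₀2, hy⟩)
      · intro y hy hyx hyQ
        obtain ⟨T₁, hT₁, rfl⟩ := hyQ
        have hT₁2 := Finset.mem_coe.1 hT₁
        by_cases h10 : T₁ = T₀
        · subst h10; exact hyx rfl
        · exact (hq T₁ hT₁2).2 T₀ hT₀2 (Ne.symm h10) hy
    · exact M.subset_closure (X \ Q) ((Set.sdiff_subset).trans hXE) ⟨hx, hxQ⟩
  -- step B: `X ∖ Q ⊆ cl((X ∖ Q) ∖ P₀)`
  have hB : X \ Q ⊆ M.closure ((X \ Q) \ P₀) := by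
    intro x hx
    by_cases hxP : x ∈ P₀
    · obtain ⟨C, hC, rfl⟩ := hxP
      have hC2 := Finset.mem_coe.1 hC
      refine mem_closure_sdiff_of_isCircuit (hDmtri C hC2).1 (hp C hC2) ?_ ?_
      · intro y hy
        have hyV : y ∈ V₀ := by rw [hV₀, Set.mem_iUnion₂]; exact ⟨C, hC2, hy⟩
        exact ⟨Or.inl hyV, fun hyQ => (hQR hyQ).2 hyV⟩
      · intro y hy hyx hyP
        obtain ⟨C₁, hC₁, rfl⟩ := hyP
        have hC₁2 := Finset.mem_coe.1 hC₁
        by_cases hCC : C₁ = C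
        · subst hCC; exact hyx rfl
        · exact Set.disjoint_left.1 (hDmdisj C hC2 C₁ hC₁2 (Ne.symm hCC)) hy (hp C₁ hC₁2)
    · exact M.subset_closure _ ((Set.sdiff_subset).trans ((Set.sdiff_subset).trans hXE)) ⟨hx, hxP⟩
  -- the nullity of `X`, then of `E`
  have hP₀X : P₀ ⊆ X \ Q := fun x hx => ⟨Or.inl (hP₀V hx), fun hxQ => (hQR hxQ).2 (hP₀V hx)⟩
  have hnX : M.eRk X + ((Q.ncard + P₀.ncard : ℕ) : ℕ∞) ≤ X.encard := by
    have h1 : M.eRk X ≤ M.eRk (X \ Q) := eRk_le_eRk_of_subset_closure hA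
    have h2 := eRk_add_encard_le_of_subset_closure hP₀X hB
    have h3 : (X \ Q).encard + Q.encard = X.encard := Set.encard_sdiff_add_encard_of_subset hQX
    have hQfin : Q.Finite := hRfin.subset hQR
    have hPfin : P₀.Finite := hV₀fin.subset hP₀V
    rw [← hQfin.cast_ncard_eq] at h3
    rw [← hPfin.cast_ncard_eq] at h2
    calc M.eRk X + ((Q.ncard + P₀.ncard : ℕ) : ℕ∞) = (M.eRk X + (P₀.ncard : ℕ∞)) + (Q.ncard : ℕ∞) := by
          push_cast; ring
      _ ≤ (M.eRk (X \ Q) + (P₀.ncard : ℕ∞)) + (Q.ncard : ℕ∞) := by gcongr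
      _ ≤ (X \ Q).encard + (Q.ncard : ℕ∞) := by gcongr
      _ = X.encard := h3
  have hnE := eRk_add_le_encard_of_subset hXE hnX
  rw [M.eRk_ground, hd] at hnE
  have hRtop : M.eRank ≠ ⊤ := (M.eRank_ne_top_iff).2 inferInstance
  have hle : ((Q.ncard + P₀.ncard : ℕ) : ℕ∞) ≤ (d : ℕ∞) := (ENat.add_le_add_iff_left hRtop).1 hnE
  have hle' : Q.ncard + P₀.ncard ≤ d := by exact_mod_cast hle
  -- the count
  have hEsplit : M.E.ncard = V₀.ncard + R.ncard := by
    rw [hR, ← Set.ncard_sdiff_add_ncard_of_subset hV₀E M.ground_finite]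
    ring
  omega

end Matroid

end PercRepro
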